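import Mathlib
import Summits.HodgeConjecture.HodgeConjecture.Theorems.HodgeLocusLVTermwiseLaw

/-!
# Hodge-locus census (cell `pub-hlocus`, ENGINE A, gen 46) — the valuation half of the three-cell
term-wise law (DERIVATION-GK-A.md §5af, Lemma 4) as kernel theorems

certified instances and evidence bearing on the general Hodge conjecture; no claim.

GENERAL (non-computational) and DEFINITION-FREE lemma sheet continuing `HodgeLocusLVTermwiseLaw.lean`
(Parts A–F there); no census data is used.  Setting of §5af (ENGINE A's transcription of the second display
of [cite: LauterViray2015SingularModuli, Thm. 1.5], arXiv:1206.6942): for a prime `ℓ`, the `x`-term of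
`T_r` involves `m_x > 0` with `4·m_x + x² = D := d₁d₂ > 0`, `d₂ = ℓ^{2k} d̃`, `k ≥ 1`; write
`v := v_ℓ(m)`.  Lemma 4 of §5af computes `v` case by case; Part E of the previous sheet did case (I) for
`ℓ ∤ 4`.  HERE, with every arithmetic object abstract (`a·m + x² = D` over `ℕ`, `ℓ ∤ a`):
* Part G — the VALUATION TRICHOTOMY: `min(2v(x), v(D)) ≤ v(m)` (`min_le_factorization`);
  `2v(x) < v(D)` ⇒ `v(m) = 2v(x)` (`factorization_eq_two_mul`); `v(D) < 2v(x)` ⇒ `v(m) = v(D)`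
  (`factorization_eq_of_lt`); outside the first case `v(D) ≤ v(m)`, with equality when `v(D)` is odd
  (`le_factorization_of_not_lt`, `factorization_eq_of_not_lt_of_odd`).
* Part H — (R), RAMIFIED `ℓ` with `ℓ ∤ a` (cell: `ℓ` odd, `a = 4`, `v_ℓ(D) = 1 + 2k + e′`,
  `e′ = v_ℓ(d̃) ∈ {0,1}`): if no nonzero core term lies in the case `2v(x) < v(D)` (hypothesis `hsq`,
  see below), then `T_r = Σ_x ρ_x F(m′_x)` (`= T_0 = T_1`) for every `r ≤ v_ℓ(D)` (`law_ramified_of_shape`),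
  and `T_r = 0` for `r > v_ℓ(D)` when `v_ℓ(D)` is odd (`law_ramified_eq_zero_of_odd`): the sub-cell
  statements `e′ = 0 ⇒ T_r = T_1 (r ≤ 2k+1), T_r = 0 (r ≥ 2k+2)`, `e′ = 1 ⇒ T_r = T_1 (r ≤ 2k+2)`.
* Part J — (I′), `ℓ` inert in `ℚ(√d₁)` and split in `ℚ(√d̃)`, `ℓ ∤ a` (cell: `u := D/ℓ^{2k} = d₁d̃`, an
  `ℓ`-unit and a NON-residue): `a·m + x² = ℓ^{2k} u` ⇒ `v(m)` is EVEN (`even_factorization_of_nonresidue`);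
  with Lemma 3's parity (nonzero core term ⇒ `v` odd) no core term survives: `T_r = 0` for all `r`
  (`law_zero_of_nonresidue`, via `law_zero_of_even`).
* Part K — `ℓ = 2` INERT (`d₁ ≡ 5 (mod 8)`; `x = 2y`, `m + y² = D/4 = 4^{k−1}·N`, `N := d₁d̃`): for `d̃` odd
  (`N` odd; `N ≡ 5·d̃ (mod 8)`): `N ≡ 5 (mod 8)` (`d̃ ≡ 1 (8)`, 2 split in `ℚ(√d̃)`) ⇒ `v(m)` even ⇒ `T_r = 0`
  (`even_factorization_two_of_mod_eight_five`, `law_zero_two_of_mod_eight_five`); `N ≡ 1 (mod 8)`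
  (`d̃ ≡ 5 (8)`) ⇒ an odd `v(m)` is `≥ 2(k−1) + 3 = 2k+1` (`factorization_two_ge_of_mod_eight_one`) ⇒
  `T_r = T_1` for odd `r ≤ 2k+1` (`law_inert_odd_two_of_mod_eight_one`); for `4 ∣ d̃` the floor is Part E
  of the previous sheet at `a = 1` (`law_inert_odd_two_of_pow_dvd`).  Inputs: `y² ≡ 1 (mod 8)` for odd `y`,
  and the threading `m = 4^{k−1}(N − y′²)` in the critical case `v₂(y) = k − 1` (`two_adic_cases`).
NOT proved here (hypotheses, as in the previous sheet): the Hilbert-symbol inputs — Lemma 2 (a nonzero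
term has `(d₁, −m)_ℓ = −1`), its use in (R) (`hsq`: in the case `2v(x) < v(D)`, `−m = (x/2)²(1 − D/x²)`
with `1 − D/x² ≡ 1 (mod ℓ)` a square unit, so the term vanishes), Lemma 3's parity (`hodd`); the `ℓ = 2`
RAMIFIED sub-cases (`g ∈ {1, 2}`) are not in this file; nor is the identification of A's code objects with
these shapes (§5af).  Nothing here concerns the truth side `T_1 (+H) = 2·v_ℓ(Res)` ([cite:
LauterViray2015SingularModuli, Thm. 1.5], [cite: GrossZagier1985SingularModuli, Thm. 1.3]).  No `sorry`,
no new axioms, no definitions.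
-/

namespace Summit.HodgeConjecture.HodgeConjecture.HodgeLocus.Census.LVValuationCases

open Finset
open Summit.HodgeConjecture.HodgeConjecture.HodgeLocus.Census.LVTermwiseLaw

set_option linter.dupNamespace false

/-! ### Part G — valuation trichotomy for `a·m + x² = D` at a prime `ℓ ∤ a` -/

section Trichotomy

variable {ℓ a D x m : ℕ}

/-- Lower bound: `min(2·v_ℓ(x), v_ℓ(D)) ≤ v_ℓ(m)` (`ℓ ∤ a`, `m ≠ 0`, `a·m + x² = D`). -/
theorem min_le_factorization (hℓ : ℓ.Prime) (ha : ¬ ℓ ∣ a) (hm : m ≠ 0) (hxD : a * m + x ^ 2 = D) :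
    min (2 * x.factorization ℓ) (D.factorization ℓ) ≤ m.factorization ℓ := by
  have hcop : Nat.Coprime (ℓ ^ min (2 * x.factorization ℓ) (D.factorization ℓ)) a :=
    Nat.Coprime.pow_left _ ((Nat.Prime.coprime_iff_not_dvd hℓ).2 ha)
  have hD : ℓ ^ min (2 * x.factorization ℓ) (D.factorization ℓ) ∣ D :=
    (pow_dvd_pow ℓ (min_le_right _ _)).trans (Nat.ordProj_dvd D ℓ)
  have hx : ℓ ^ min (2 * x.factorization ℓ) (D.factorization ℓ) ∣ x ^ 2 := by
    refine (pow_dvd_pow ℓ (min_le_left _ _)).trans ?_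
    rw [mul_comm, pow_mul]
    exact pow_dvd_pow_of_dvd (Nat.ordProj_dvd x ℓ) 2
  have ham : ℓ ^ min (2 * x.factorization ℓ) (D.factorization ℓ) ∣ a * m := by
    rw [show a * m = D - x ^ 2 by omega]
    exact Nat.dvd_sub hD hx
  exact (hℓ.pow_dvd_iff_le_factorization hm).1 (hcop.dvd_of_dvd_mul_left ham)

/-- Case 1: `2·v(x) < v(D)` and `x ≠ 0` ⇒ `v(m) = 2·v(x)` (even). -/
theorem factorization_eq_two_mul (hℓ : ℓ.Prime) (ha : ¬ ℓ ∣ a) (hm : m ≠ 0) (hx : x ≠ 0)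
    (hxD : a * m + x ^ 2 = D) (hlt : 2 * x.factorization ℓ < D.factorization ℓ) :
    m.factorization ℓ = 2 * x.factorization ℓ := by
  have hlow := min_le_factorization hℓ ha hm hxD
  rw [min_eq_left hlt.le] at hlow
  have hx2 : (x ^ 2).factorization ℓ = 2 * x.factorization ℓ := by
    rw [Nat.factorization_pow, Finsupp.smul_apply, smul_eq_mul]
  have hD0 : D ≠ 0 := by have := pow_pos (Nat.pos_of_ne_zero hx) 2; omega
  have hhigh : ¬ 2 * x.factorization ℓ + 1 ≤ m.factorization ℓ := by
    intro hle
    have h1 : ℓ ^ (2 * x.factorization ℓ + 1) ∣ a * m :=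
      ((hℓ.pow_dvd_iff_le_factorization hm).2 hle).mul_left a
    have h2 : ℓ ^ (2 * x.factorization ℓ + 1) ∣ D :=
      (hℓ.pow_dvd_iff_le_factorization hD0).2 (by omega)
    have h3 : ℓ ^ (2 * x.factorization ℓ + 1) ∣ x ^ 2 := by
      rw [show x ^ 2 = D - a * m by omega]
      exact Nat.dvd_sub h2 h1
    have h4 := (hℓ.pow_dvd_iff_le_factorization (pow_ne_zero 2 hx)).1 h3
    rw [hx2] at h4
    omega
  omega

/-- Case 2: `v(D) < 2·v(x)` and `D ≠ 0` ⇒ `v(m) = v(D)`. -/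
theorem factorization_eq_of_lt (hℓ : ℓ.Prime) (ha : ¬ ℓ ∣ a) (hm : m ≠ 0) (hD0 : D ≠ 0)
    (hxD : a * m + x ^ 2 = D) (hlt : D.factorization ℓ < 2 * x.factorization ℓ) :
    m.factorization ℓ = D.factorization ℓ := by
  have hlow := min_le_factorization hℓ ha hm hxD
  rw [min_eq_right hlt.le] at hlow
  have hx : x ≠ 0 := by
    rintro rfl
    rw [Nat.factorization_zero, Finsupp.zero_apply] at hlt
    omega
  have hx2 : (x ^ 2).factorization ℓ = 2 * x.factorization ℓ := by
    rw [Nat.factorization_pow, Finsupp.smul_apply, smul_eq_mul]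
  have hhigh : ¬ D.factorization ℓ + 1 ≤ m.factorization ℓ := by
    intro hle
    have h1 : ℓ ^ (D.factorization ℓ + 1) ∣ a * m :=
      ((hℓ.pow_dvd_iff_le_factorization hm).2 hle).mul_left a
    have h3 : ℓ ^ (D.factorization ℓ + 1) ∣ x ^ 2 :=
      (hℓ.pow_dvd_iff_le_factorization (pow_ne_zero 2 hx)).2 (by rw [hx2]; omega)
    have h2 : ℓ ^ (D.factorization ℓ + 1) ∣ a * m + x ^ 2 := dvd_add h1 h3
    rw [hxD] at h2
    have h4 := (hℓ.pow_dvd_iff_le_factorization hD0).1 h2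
    omega
  omega

/-- Outside case 1: `v(D) ≤ v(m)`. -/
theorem le_factorization_of_not_lt (hℓ : ℓ.Prime) (ha : ¬ ℓ ∣ a) (hm : m ≠ 0)
    (hxD : a * m + x ^ 2 = D) (hnlt : ¬ 2 * x.factorization ℓ < D.factorization ℓ) :
    D.factorization ℓ ≤ m.factorization ℓ := by
  have hlow := min_le_factorization hℓ ha hm hxD
  rwa [min_eq_right (not_lt.1 hnlt)] at hlow

/-- Outside case 1 with `v(D)` odd (so case 3, `v(D) = 2v(x)`, is impossible): `v(m) = v(D)` exactly. -/
theorem factorization_eq_of_not_lt_of_odd (hℓ : ℓ.Prime) (ha : ¬ ℓ ∣ a) (hm : m ≠ 0)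
    (hxD : a * m + x ^ 2 = D) (hnlt : ¬ 2 * x.factorization ℓ < D.factorization ℓ)
    (hodd : Odd (D.factorization ℓ)) : m.factorization ℓ = D.factorization ℓ := by
  have hD0 : D ≠ 0 := by
    rintro rfl
    obtain ⟨t, ht⟩ := hodd
    rw [Nat.factorization_zero, Finsupp.zero_apply] at ht
    omega
  have hne : D.factorization ℓ ≠ 2 * x.factorization ℓ := fun h =>
    (Nat.not_even_iff_odd.2 hodd) ⟨x.factorization ℓ, by rw [h]; ring⟩
  exact factorization_eq_of_lt hℓ ha hm hD0 hxD (lt_of_le_of_ne (not_lt.1 hnlt) hne)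

end Trichotomy

/-! ### Part H — (R): the ramified cell for a prime `ℓ ∤ a`, composed with Part D -/

section Ramified

variable {ι : Type*} {ℓ : ℕ} (s : Finset ι) (F : ℕ → ℤ) (c : ℕ → ℤ) (ρ : ι → ℤ) (m' v : ι → ℕ)

/-- (R), floor: `c ≡ 1`, every term of the shape `a·m_x + X_x² = D` (`m_x = ℓ^{v_x} m′_x`, `ℓ ∤ a m′_x`),
and no nonzero core term in the case `2v(X_x) < v(D)` (`hsq`, the Hilbert-symbol input) ⇒
`T_r = Σ_x ρ_x F(m′_x)` for every `r ≤ v_ℓ(D)` (cell: `v_ℓ(D) = 2k + 1 + e′`). -/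
theorem law_ramified_of_shape (hℓ : ℓ.Prime) (hF : ∀ e n, ¬ ℓ ∣ n → F (ℓ ^ e * n) = c e * F n)
    (hc : ∀ e, c e = 1) (hm' : ∀ x ∈ s, ¬ ℓ ∣ m' x) {a D : ℕ} (ha : ¬ ℓ ∣ a) (X : ι → ℕ)
    (hshape : ∀ x ∈ s, a * (ℓ ^ v x * m' x) + X x ^ 2 = D)
    (hsq : ∀ x ∈ s, ρ x * F (m' x) ≠ 0 → ¬ 2 * (X x).factorization ℓ < D.factorization ℓ)
    {r : ℕ} (hr : r ≤ D.factorization ℓ) :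
    ∑ x ∈ s, (if ℓ ^ r ∣ ℓ ^ v x * m' x then ρ x * F (ℓ ^ v x * m' x / ℓ ^ r) else 0)
      = ∑ x ∈ s, ρ x * F (m' x) := by
  refine law_ramified s F c ρ m' v hℓ hF hc hm' (D.factorization ℓ) ?_ hr
  intro x hx hw
  have hm0 : ℓ ^ v x * m' x ≠ 0 :=
    mul_ne_zero (pow_ne_zero _ hℓ.ne_zero) (fun h0 => hm' x hx (h0 ▸ dvd_zero ℓ))
  have h := le_factorization_of_not_lt hℓ ha hm0 (hshape x hx) (hsq x hx hw)
  rwa [factorization_prime_pow_mul hℓ (hm' x hx) (v x)] at h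

/-- (R), vanishing beyond: if moreover `v_ℓ(D)` is ODD (cell: `e′ = 0`, `v_ℓ(D) = 2k + 1`), every nonzero
core term has `v_x = v_ℓ(D)` exactly, so `T_r = 0` for every `r > v_ℓ(D)`. -/
theorem law_ramified_eq_zero_of_odd (hℓ : ℓ.Prime) (hF : ∀ e n, ¬ ℓ ∣ n → F (ℓ ^ e * n) = c e * F n)
    (hm' : ∀ x ∈ s, ¬ ℓ ∣ m' x) {a D : ℕ} (ha : ¬ ℓ ∣ a) (X : ι → ℕ)
    (hshape : ∀ x ∈ s, a * (ℓ ^ v x * m' x) + X x ^ 2 = D)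
    (hsq : ∀ x ∈ s, ρ x * F (m' x) ≠ 0 → ¬ 2 * (X x).factorization ℓ < D.factorization ℓ)
    (hE : Odd (D.factorization ℓ)) {r : ℕ} (hr : D.factorization ℓ < r) :
    ∑ x ∈ s, (if ℓ ^ r ∣ ℓ ^ v x * m' x then ρ x * F (ℓ ^ v x * m' x / ℓ ^ r) else 0) = 0 := by
  refine law_eq_zero_of_gt s F c ρ m' v hℓ hF hm' (D.factorization ℓ) ?_ hr
  intro x hx hw
  have hm0 : ℓ ^ v x * m' x ≠ 0 :=
    mul_ne_zero (pow_ne_zero _ hℓ.ne_zero) (fun h0 => hm' x hx (h0 ▸ dvd_zero ℓ))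
  have h := factorization_eq_of_not_lt_of_odd hℓ ha hm0 (hshape x hx) (hsq x hx hw) hE
  rw [factorization_prime_pow_mul hℓ (hm' x hx) (v x)] at h
  exact h.le

end Ramified

/-! ### Part J — (I′): a non-residue unit core forces an even valuation -/

section NonResidue

/-- (I′) for a prime `ℓ ∤ a`: if `a·m + x² = ℓ^{2k}·u` with `ℓ ∤ u`, `u` not a square modulo `ℓ`, and
`m ≠ 0`, then `v_ℓ(m)` is EVEN.  (Cell: `ℓ` odd, `a = 4`, `u = d₁d̃` with `(d₁/ℓ) = −1`, `(d̃/ℓ) = +1`.)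
Case 3 of the trichotomy (`v(x) = k`) gives `a m = ℓ^{2k}(u − x′²)` with `u − x′²` an `ℓ`-unit. -/
theorem even_factorization_of_nonresidue {ℓ a k u x m : ℕ} (hℓ : ℓ.Prime) (ha : ¬ ℓ ∣ a)
    (hu : ¬ ℓ ∣ u) (hnr : ∀ t : ℕ, ¬ u ≡ t ^ 2 [MOD ℓ]) (hm : m ≠ 0)
    (hxD : a * m + x ^ 2 = ℓ ^ (2 * k) * u) : Even (m.factorization ℓ) := by
  have hE : (ℓ ^ (2 * k) * u).factorization ℓ = 2 * k := factorization_prime_pow_mul hℓ hu (2 * k)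
  have hu0 : u ≠ 0 := fun h0 => hu (h0 ▸ dvd_zero ℓ)
  have hD0 : ℓ ^ (2 * k) * u ≠ 0 := mul_ne_zero (pow_ne_zero _ hℓ.ne_zero) hu0
  have ha0 : a ≠ 0 := fun h0 => ha (h0 ▸ dvd_zero ℓ)
  have hva : ∀ n, n ≠ 0 → (a * n).factorization ℓ = n.factorization ℓ := fun n hn => by
    rw [Nat.factorization_mul ha0 hn, Finsupp.add_apply, Nat.factorization_eq_zero_of_not_dvd ha,
      zero_add]
  by_cases hx : x = 0
  · subst hx
    have ham : a * m = ℓ ^ (2 * k) * u := by simpa using hxD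
    have h := factorization_prime_pow_mul hℓ hu (2 * k)
    rw [← ham, hva m hm] at h
    exact ⟨k, by rw [h]; ring⟩
  rcases lt_trichotomy (2 * x.factorization ℓ) (2 * k) with hlt | heq | hgt
  · rw [factorization_eq_two_mul hℓ ha hm hx hxD (by rw [hE]; exact hlt)]
    exact even_two_mul _
  · have hxx : ℓ ^ x.factorization ℓ * (x / ℓ ^ x.factorization ℓ) = x :=
      Nat.ordProj_mul_ordCompl_eq_self x ℓ
    have hx' : ¬ ℓ ∣ x / ℓ ^ x.factorization ℓ := Nat.not_dvd_ordCompl hℓ hx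
    have hjk : x.factorization ℓ = k := by omega
    rw [hjk] at hxx hx'
    set x' := x / ℓ ^ k with hx'def
    have hx2 : x ^ 2 = ℓ ^ (2 * k) * x' ^ 2 := by rw [← hxx, mul_pow, ← pow_mul, mul_comm k 2]
    have hle : x' ^ 2 ≤ u :=
      Nat.le_of_mul_le_mul_left (by rw [← hx2]; omega) (pow_pos hℓ.pos (2 * k))
    have ham : a * m = ℓ ^ (2 * k) * (u - x' ^ 2) := by
      have h : ℓ ^ (2 * k) * (u - x' ^ 2) + ℓ ^ (2 * k) * x' ^ 2 = ℓ ^ (2 * k) * u := by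
        rw [← mul_add, Nat.sub_add_cancel hle]
      omega
    have hn : ¬ ℓ ∣ u - x' ^ 2 := fun hd =>
      hnr x' (((Nat.modEq_iff_dvd' hle).2 hd).symm)
    have hn0 : u - x' ^ 2 ≠ 0 := fun h0 => hn (h0 ▸ dvd_zero ℓ)
    have h := factorization_prime_pow_mul hℓ hn (2 * k)
    rw [← ham, hva m hm] at h
    exact ⟨k, by rw [h]; ring⟩
  · rw [factorization_eq_of_lt hℓ ha hm hD0 hxD (by rw [hE]; exact hgt), hE]
    exact even_two_mul _

end NonResidue

/-! ### Part K — `ℓ = 2`, inert cell: the critical case through `y² ≡ 1 (mod 8)` -/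

section TwoAdic

/-- An odd square is `≡ 1 (mod 8)`. -/
theorem sq_mod_eight_of_odd {y : ℕ} (hy : ¬ 2 ∣ y) : y ^ 2 % 8 = 1 := by
  have h : y % 8 = 1 ∨ y % 8 = 3 ∨ y % 8 = 5 ∨ y % 8 = 7 := by omega
  rcases h with h | h | h | h <;> simp [Nat.pow_mod, h]

/-- `N ≡ 5 (mod 8)`, `y` odd, `N − y² ≠ 0` ⇒ `v₂(N − y²) = 2`. -/
theorem factorization_two_eq_two {N y : ℕ} (hN : N % 8 = 5) (hy : ¬ 2 ∣ y) (hn : N - y ^ 2 ≠ 0) :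
    (N - y ^ 2).factorization 2 = 2 := by
  have h1 := sq_mod_eight_of_odd hy
  have h4 : 2 ^ 2 ∣ N - y ^ 2 := by omega
  have h8 : ¬ 2 ^ 3 ∣ N - y ^ 2 := by omega
  have hge := (Nat.prime_two.pow_dvd_iff_le_factorization hn).1 h4
  have hlt : ¬ 3 ≤ (N - y ^ 2).factorization 2 := fun h =>
    h8 ((Nat.prime_two.pow_dvd_iff_le_factorization hn).2 h)
  omega

/-- `N ≡ 1 (mod 8)`, `y` odd ⇒ `8 ∣ N − y²`. -/
theorem eight_dvd_sub_sq {N y : ℕ} (hN : N % 8 = 1) (hy : ¬ 2 ∣ y) : 2 ^ 3 ∣ N - y ^ 2 := by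
  have h1 := sq_mod_eight_of_odd hy
  omega

/-- The `2`-adic cases for `m + y² = 2^{2k′}·N` with `N` odd and `m ≠ 0`: either `v₂(m)` is even
(cases 1, 2 of the trichotomy and `y = 0`), or `v₂(y) = k′`, `y = 2^{k′} y′` with `y′` odd,
`m = 2^{2k′}(N − y′²)` and `v₂(m) = 2k′ + v₂(N − y′²)`. -/
theorem two_adic_cases {k' N y m : ℕ} (hN : ¬ 2 ∣ N) (hm : m ≠ 0)
    (hyD : m + y ^ 2 = 2 ^ (2 * k') * N) :
    Even (m.factorization 2) ∨
      ∃ y', ¬ 2 ∣ y' ∧ N - y' ^ 2 ≠ 0 ∧ m.factorization 2 = 2 * k' + (N - y' ^ 2).factorization 2 := by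
  have h2 := Nat.prime_two
  have hE : (2 ^ (2 * k') * N).factorization 2 = 2 * k' := factorization_prime_pow_mul h2 hN (2 * k')
  have hN0 : N ≠ 0 := fun h0 => hN (h0 ▸ dvd_zero 2)
  have hD0 : 2 ^ (2 * k') * N ≠ 0 := mul_ne_zero (pow_ne_zero _ two_ne_zero) hN0
  have hxD : 1 * m + y ^ 2 = 2 ^ (2 * k') * N := by rw [one_mul]; exact hyD
  have h1 : ¬ 2 ∣ 1 := by omega
  by_cases hy : y = 0
  · left
    subst hy
    have h : m = 2 ^ (2 * k') * N := by simpa using hyD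
    rw [h, hE]
    exact even_two_mul k'
  rcases lt_trichotomy (2 * y.factorization 2) (2 * k') with hlt | heq | hgt
  · left
    rw [factorization_eq_two_mul h2 h1 hm hy hxD (by rw [hE]; exact hlt)]
    exact even_two_mul _
  · right
    have hyy : 2 ^ y.factorization 2 * (y / 2 ^ y.factorization 2) = y :=
      Nat.ordProj_mul_ordCompl_eq_self y 2
    have hy' : ¬ 2 ∣ y / 2 ^ y.factorization 2 := Nat.not_dvd_ordCompl h2 hy
    have hjk : y.factorization 2 = k' := by omega
    rw [hjk] at hyy hy'
    set y' := y / 2 ^ k' with hy'def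
    have hy2 : y ^ 2 = 2 ^ (2 * k') * y' ^ 2 := by rw [← hyy, mul_pow, ← pow_mul, mul_comm k' 2]
    have hle : y' ^ 2 ≤ N :=
      Nat.le_of_mul_le_mul_left (by rw [← hy2]; omega) (pow_pos two_pos (2 * k'))
    have hmeq : m = 2 ^ (2 * k') * (N - y' ^ 2) := by
      have h : 2 ^ (2 * k') * (N - y' ^ 2) + 2 ^ (2 * k') * y' ^ 2 = 2 ^ (2 * k') * N := by
        rw [← mul_add, Nat.sub_add_cancel hle]
      omega
    have hn0 : N - y' ^ 2 ≠ 0 := fun h0 => hm (by rw [hmeq, h0, mul_zero])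
    refine ⟨y', hy', hn0, ?_⟩
    rw [hmeq, Nat.factorization_mul (pow_ne_zero _ two_ne_zero) hn0, Finsupp.add_apply,
      h2.factorization_pow, Finsupp.single_eq_same]
  · left
    rw [factorization_eq_of_lt h2 h1 hm hD0 hxD (by rw [hE]; exact hgt), hE]
    exact even_two_mul _

/-- (I′) at `ℓ = 2`: `m + y² = 2^{2k′}·N`, `N ≡ 5 (mod 8)`, `m ≠ 0` ⇒ `v₂(m)` EVEN
(cell: `k′ = k − 1`, `N = d₁d̃` with `d₁ ≡ 5`, `d̃ ≡ 1 (mod 8)`; then `v = 2k` in the critical case). -/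
theorem even_factorization_two_of_mod_eight_five {k' N y m : ℕ} (hN : N % 8 = 5) (hm : m ≠ 0)
    (hyD : m + y ^ 2 = 2 ^ (2 * k') * N) : Even (m.factorization 2) := by
  rcases two_adic_cases (by omega) hm hyD with h | ⟨y', hy', hn0, hv⟩
  · exact h
  · rw [hv, factorization_two_eq_two hN hy' hn0]
    exact ⟨k' + 1, by ring⟩

/-- (I) at `ℓ = 2`, `d̃` odd: `m + y² = 2^{2k′}·N`, `N ≡ 1 (mod 8)`, `m ≠ 0`, `v₂(m)` ODD ⇒
`v₂(m) ≥ 2k′ + 3` (cell: `k′ = k − 1`, so `v ≥ 2k + 1`; `N = d₁d̃` with `d₁ ≡ d̃ ≡ 5 (mod 8)`). -/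
theorem factorization_two_ge_of_mod_eight_one {k' N y m : ℕ} (hN : N % 8 = 1) (hm : m ≠ 0)
    (hyD : m + y ^ 2 = 2 ^ (2 * k') * N) (hodd : Odd (m.factorization 2)) :
    2 * k' + 3 ≤ m.factorization 2 := by
  rcases two_adic_cases (by omega) hm hyD with h | ⟨y', hy', hn0, hv⟩
  · exact absurd h (Nat.not_even_iff_odd.2 hodd)
  · have h8 := (Nat.prime_two.pow_dvd_iff_le_factorization hn0).1 (eight_dvd_sub_sq hN hy')
    omega

end TwoAdic

/-! ### Part L — the composed `T_r` statements for (I′) and for `ℓ = 2` inert -/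

section LawCases

variable {ι : Type*} (s : Finset ι) (F : ℕ → ℤ) (c : ℕ → ℤ) (ρ : ι → ℤ) (m' v : ι → ℕ)

/-- Any cell: if every term has EVEN valuation while every nonzero core term must have ODD valuation
(Lemma 3), then no core term survives and `T_r = 0` for all `r`. -/
theorem law_zero_of_even {ℓ : ℕ} (hℓ : ℓ.Prime) (hF : ∀ e n, ¬ ℓ ∣ n → F (ℓ ^ e * n) = c e * F n)
    (hm' : ∀ x ∈ s, ¬ ℓ ∣ m' x) (hodd : ∀ x ∈ s, ρ x * F (m' x) ≠ 0 → Odd (v x))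
    (heven : ∀ x ∈ s, Even (v x)) (r : ℕ) :
    ∑ x ∈ s, (if ℓ ^ r ∣ ℓ ^ v x * m' x then ρ x * F (ℓ ^ v x * m' x / ℓ ^ r) else 0) = 0 :=
  law_split s F c ρ m' v hℓ hF hm' (fun x hx => by
    by_contra hw
    exact (Nat.not_even_iff_odd.2 (hodd x hx hw)) (heven x hx)) r

/-- (I′), prime `ℓ ∤ a`: terms of the shape `a·m_x + X_x² = ℓ^{2k}·u`, `u` a non-residue `ℓ`-unit,
Lemma 3's parity on nonzero core terms ⇒ `T_r = 0` for every `r ≥ 0`. -/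
theorem law_zero_of_nonresidue {ℓ : ℕ} (hℓ : ℓ.Prime)
    (hF : ∀ e n, ¬ ℓ ∣ n → F (ℓ ^ e * n) = c e * F n) (hm' : ∀ x ∈ s, ¬ ℓ ∣ m' x)
    {a k u : ℕ} (ha : ¬ ℓ ∣ a) (hu : ¬ ℓ ∣ u) (hnr : ∀ t : ℕ, ¬ u ≡ t ^ 2 [MOD ℓ]) (X : ι → ℕ)
    (hshape : ∀ x ∈ s, a * (ℓ ^ v x * m' x) + X x ^ 2 = ℓ ^ (2 * k) * u)
    (hodd : ∀ x ∈ s, ρ x * F (m' x) ≠ 0 → Odd (v x)) (r : ℕ) :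
    ∑ x ∈ s, (if ℓ ^ r ∣ ℓ ^ v x * m' x then ρ x * F (ℓ ^ v x * m' x / ℓ ^ r) else 0) = 0 := by
  refine law_zero_of_even s F c ρ m' v hℓ hF hm' hodd (fun x hx => ?_) r
  have hm0 : ℓ ^ v x * m' x ≠ 0 :=
    mul_ne_zero (pow_ne_zero _ hℓ.ne_zero) (fun h0 => hm' x hx (h0 ▸ dvd_zero ℓ))
  have h := even_factorization_of_nonresidue hℓ ha hu hnr hm0 (hshape x hx)
  rwa [factorization_prime_pow_mul hℓ (hm' x hx) (v x)] at h

/-- (I′) at `ℓ = 2` (`d₁ ≡ 5`, `d̃ ≡ 1 (mod 8)`): terms `m_x + Y_x² = 2^{2k′}·N` with `N ≡ 5 (mod 8)`,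
Lemma 3's parity ⇒ `T_r = 0` for every `r ≥ 0`. -/
theorem law_zero_two_of_mod_eight_five (hF : ∀ e n, ¬ 2 ∣ n → F (2 ^ e * n) = c e * F n)
    (hm' : ∀ x ∈ s, ¬ 2 ∣ m' x) {k' N : ℕ} (hN : N % 8 = 5) (Y : ι → ℕ)
    (hshape : ∀ x ∈ s, 2 ^ v x * m' x + Y x ^ 2 = 2 ^ (2 * k') * N)
    (hodd : ∀ x ∈ s, ρ x * F (m' x) ≠ 0 → Odd (v x)) (r : ℕ) :
    ∑ x ∈ s, (if 2 ^ r ∣ 2 ^ v x * m' x then ρ x * F (2 ^ v x * m' x / 2 ^ r) else 0) = 0 := by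
  refine law_zero_of_even s F c ρ m' v Nat.prime_two hF hm' hodd (fun x hx => ?_) r
  have hm0 : 2 ^ v x * m' x ≠ 0 :=
    mul_ne_zero (pow_ne_zero _ two_ne_zero) (fun h0 => hm' x hx (h0 ▸ dvd_zero 2))
  have h := even_factorization_two_of_mod_eight_five hN hm0 (hshape x hx)
  rwa [factorization_prime_pow_mul Nat.prime_two (hm' x hx) (v x)] at h

/-- (I) at `ℓ = 2`, `d̃` odd (`d₁ ≡ d̃ ≡ 5 (mod 8)`): terms `m_x + Y_x² = 2^{2k′}·N` with `N ≡ 1 (mod 8)`,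
inert factor `c(e) = [e even]`, Lemma 3's parity ⇒ `T_r = T_1` for every odd `r ≤ 2k′ + 3` (`= 2k + 1`). -/
theorem law_inert_odd_two_of_mod_eight_one (hF : ∀ e n, ¬ 2 ∣ n → F (2 ^ e * n) = c e * F n)
    (hc : ∀ e, c e = if Even e then 1 else 0) (hm' : ∀ x ∈ s, ¬ 2 ∣ m' x) {k' N : ℕ}
    (hN : N % 8 = 1) (Y : ι → ℕ) (hshape : ∀ x ∈ s, 2 ^ v x * m' x + Y x ^ 2 = 2 ^ (2 * k') * N)
    (hodd : ∀ x ∈ s, ρ x * F (m' x) ≠ 0 → Odd (v x)) {r : ℕ} (hr : Odd r) (hrK : r ≤ 2 * k' + 3) :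
    ∑ x ∈ s, (if 2 ^ r ∣ 2 ^ v x * m' x then ρ x * F (2 ^ v x * m' x / 2 ^ r) else 0)
      = ∑ x ∈ s, (if 2 ^ 1 ∣ 2 ^ v x * m' x then ρ x * F (2 ^ v x * m' x / 2 ^ 1) else 0) := by
  refine law_inert_odd s F c ρ m' v Nat.prime_two hF hc hm' hodd (2 * k' + 3) ?_ hr hrK
  intro x hx hw
  have hm0 : 2 ^ v x * m' x ≠ 0 :=
    mul_ne_zero (pow_ne_zero _ two_ne_zero) (fun h0 => hm' x hx (h0 ▸ dvd_zero 2))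
  have hv := factorization_prime_pow_mul Nat.prime_two (hm' x hx) (v x)
  have h := factorization_two_ge_of_mod_eight_one hN hm0 (hshape x hx)
    (by rw [hv]; exact hodd x hx hw)
  rwa [hv] at h

/-- (I) at `ℓ = 2`, `4 ∣ d̃` (`2^{2k} ∣ D′ = D/4`): terms `m_x + Y_x² = D′`, Lemma 3's parity ⇒ `T_r = T_1`
for every odd `r ≤ 2k + 1` — Part E/F of the previous sheet at `a = 1`. -/
theorem law_inert_odd_two_of_pow_dvd (hF : ∀ e n, ¬ 2 ∣ n → F (2 ^ e * n) = c e * F n)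
    (hc : ∀ e, c e = if Even e then 1 else 0) (hm' : ∀ x ∈ s, ¬ 2 ∣ m' x) {k D' : ℕ}
    (hD : 2 ^ (2 * k) ∣ D') (Y : ι → ℕ) (hshape : ∀ x ∈ s, 2 ^ v x * m' x + Y x ^ 2 = D')
    (hodd : ∀ x ∈ s, ρ x * F (m' x) ≠ 0 → Odd (v x)) {r : ℕ} (hr : Odd r) (hrK : r ≤ 2 * k + 1) :
    ∑ x ∈ s, (if 2 ^ r ∣ 2 ^ v x * m' x then ρ x * F (2 ^ v x * m' x / 2 ^ r) else 0)
      = ∑ x ∈ s, (if 2 ^ 1 ∣ 2 ^ v x * m' x then ρ x * F (2 ^ v x * m' x / 2 ^ 1) else 0) :=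
  law_inert_odd_of_shape s F c ρ m' v Nat.prime_two hF hc hm' (a := 1) (by omega) hD Y
    (fun x hx => by rw [one_mul]; exact hshape x hx) hodd hr hrK

end LawCases

end Summit.HodgeConjecture.HodgeConjecture.HodgeLocus.Census.LVValuationCases
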